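import Summits.NavierStokesRegularity.NavierStokesRegularity.Theorems.AxisTwistDoorAveragedConeLiouvilleHolds
import HarnessLib

/-!
# Crux `AveragedConeLiouville` (stmt-NavierStokesRegularity-26889), line `lrt_shell` — skeleton v10 (CLOSED, no stubs)

v9's only stub `fact_leiRen2024` (Lei–Ren 2024 quantitative regular shells) is GONE: the route's specialised shell input
`ShellFact` is proved in the tree (`…AveragedConeLiouville.Shell.shellFact_holds`, ns-inputs N3, p638473) and the crux
closer `…AxisTwistDoorAveragedConeLiouvilleHolds.averagedConeLiouville_holds` (p639289) is unconditional; item closed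
`proved` 2026-08-28T14:00:28Z.  This skeleton of record is the one-line composition.
-/

noncomputable section

set_option linter.dupNamespace false

namespace Summit.NavierStokesRegularity.NavierStokesRegularity.Cruxes.AveragedConeLiouville.LrtShell

/-- The crux BY NAME, no stubs. -/
theorem AveragedConeLiouville_of :
    Summit.NavierStokesRegularity.NavierStokesRegularity.Theses.AxisTwistDoor.AveragedConeLiouville :=
  Summit.NavierStokesRegularity.NavierStokesRegularity.Theorems.AxisTwistDoorAveragedConeLiouvilleHolds.averagedConeLiouville_holds

end Summit.NavierStokesRegularity.NavierStokesRegularity.Cruxes.AveragedConeLiouville.LrtShell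

end
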